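import Literature.RepresentationTheory.KonnoKonno2007.FockModelUnitaryDualPair
import Literature.NumberTheory.Automorphic.UnitaryGroupDirectSum
import Literature.NumberTheory.Automorphic.UnitaryGroupFormTransport
import HarnessLib

/-!
# The real unitary dual pair `U(p,q) × U(r,s) → Sp(𝕎)` in the Fock block coordinates — an instance of
`RealDualPairJunction` (kernel, group side)

`Literature/RepresentationTheory/KonnoKonno2007/FockModelUnitaryDualPair.lean` declares the HYPOTHESIS
STRUCTURE `RealDualPairJunction P Q R S Ginf`: an abstract topological group `Ginf` with a homomorphism
`ι𝕎 : Ginf →* Sp(𝕎)` to the real symplectic group of `𝕎 = V ⊗_ℂ W` written in the block coordinates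
`DPIdx P Q R S = ((P × R) ⊕ (Q × S)) ⊕ ((P × S) ⊕ (Q × R))` of the tree (`FockDualPairCompact`), the inclusion
`κ` of the maximal compact `K_V × K_W = (U(P) × U(Q)) × (U(R) × U(S))`, and the compatibility
`ι𝕎 ∘ κ = realifySp ∘ dualPairι`.  This file CONSTRUCTS the standard instance — nothing is postulated:

* `Ginf P Q R S = U(P,Q) × U(R,S)`, where `U(α,β) = U(⋆, diag(1_α, −1_β)) ≤ GL_{α ⊕ β}(ℂ)` is the tree's
  `unitaryGroupOfForm (starRingEnd ℂ) (signForm α β)` (`UnitaryGroupAutomorphicRep`), i.e. the real points of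
  the unitary groups of the hermitian space `V = ℂ^P ⊕ ℂ^Q` of signature `(p,q)` and of `W = ℂ^R ⊕ ℂ^S` of
  signature `(r,s)` in diagonal frames [MVW, Ch. 1 I.17; KonnoKonno2007 §3.1 (3.1) `G_V × G_W`];
* `κ ((a,b),(c,d)) = (diag(a,b), diag(c,d))` (the tree's `UnitaryGroup.blockDiag`);
* `ι𝕎 (g_V, g_W)` = the real-linear automorphism of `𝕎_ℝ = ℝ^{DPIdx} × ℝ^{DPIdx}` given by `g_V ⊗ g_W` on
  `V ⊗_ℂ W = ℂ^{(P ⊕ Q) × (R ⊕ S)} ≃ ℂ^{DPIdx}` (`dpEquiv`), read through the tree's identification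
  `(p, q) ↔ p + iq` (`phasePt`) AFTER conjugating the complex coordinates of the two same-sign blocks
  `P × R`, `Q × S` — the convention fixed by the tree's compact datum `dualPairι`, which conjugates exactly those
  blocks ("Ichino's sign realised in Folland's conventions", `FockDualPairCompact`).  In formulas:
  `phasePt` of `ι𝕎 g (p,q)` is `tw (M_g *ᵥ tw (p + iq))`, `tw` = conjugation of the `Sum.inl` coordinates,
  `M_g = reindex dpEquiv dpEquiv (g_V ⊗ₖ g_W)` (`phasePt_ι𝕎`).

WHY `ι𝕎 g` IS SYMPLECTIC (kernel, `twRealifyLin_mem_symplecticGroup`): `g_V ⊗ g_W` preserves the hermitian form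
`H_V ⊗ H_W`, which in the `DPIdx` frame is `D = diag(+1 on the same-sign blocks, −1 on the mixed blocks)`
(`reindex_signForm_kronecker`); hence it preserves `Im(x̄ᵀ D y)`; and for the twisted coordinates `x = tw x̃` one has
`Im(x̄ᵀ D y) = −Im(conj(x̃)ᵀ ỹ)` (`im_star_tw_dotProduct_tw`), while `Im(conj(p+iq)ᵀ (p′+iq′)) = p·q′ − p′·q` is the
tree's symplectic form `polar (dotPairing _)` (`im_star_phasePt_dotProduct`).  So the twisted realification of
ANY `M` with `Mᴴ D M = D` is symplectic (`UForm.toSp : U(α,β) →* Sp(ℝ^{α⊕β} × ℝ^{α⊕β})` — the standard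
embedding of an indefinite unitary group in the symplectic group of the underlying real space), and on the
block-unitary elements `diag(u₁,u₂)`, `u₁ ∈ U(α)`, `u₂ ∈ U(β)`, it is the tree's `realifySp (diag(ū₁, u₂))`
(`toSp_eq_realifySp`) — which is exactly the shape of `dualPairι`, whence `ι𝕎_κ`.

MAIN DEFINITIONS / RESULTS
* `signForm α β`, `UForm α β`, `UForm.ofUnitaryOne/NegOne`, `UForm.kV` (+ `coe_kV`, `continuous_kV`);
* `tw`, `twMulVec`, `twRealify`, `twRealifyLin`, `twRealifyLin_mem_symplecticGroup`, `UForm.toSp`,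
  `UForm.toSp_eq_realifySp`;
* `dpEquiv : (P ⊕ Q) × (R ⊕ S) ≃ DPIdx P Q R S`, `reindex_signForm_kronecker`, `reindex_kronecker_fromBlocks`;
* `Ginf`, `toBig : Ginf →* UForm _ _` (+ `coe_toBig`), `ι𝕎`, `κ`, `phasePt_ι𝕎`, `ι𝕎_κ`;
* **`junction P Q R S : RealDualPairJunction P Q R S (Ginf P Q R S)`** — the instance.

BOUNDARY.  Everything here is constructed and kernel-checked; no `Prop` is introduced, no published VALUE is
recorded.  The print row `FockVacuumCharacter D e` of the record file is NOT touched: it stays a hypothesis of its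
consumers, now about the concrete `D = junction P Q R S`.

References: C. Mœglin, M.-F. Vignéras, J.-L. Waldspurger, LNM 1291 (1987), Ch. 1 I.17 (dual pairs `(U(V), U(W))`
in `Sp(V ⊗ W)`); K. Konno, T. Konno, Kyushu J. Math. 61 (2007), §3.1 (3.1); G. B. Folland, Harmonic Analysis in
Phase Space (1989), Prop. (4.39) (`U(n) ⊂ Sp(2n,ℝ)` via `p + iq`).
-/

set_option autoImplicit false

noncomputable section

open Matrix Complex
open scoped Kronecker ComplexConjugate
open Literature.Analysis.SegalBargmann Literature.RepresentationTheory.HeisenbergGroup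
open Literature.NumberTheory.Automorphic Literature.NumberTheory.Automorphic.UnitaryGroup

namespace Literature.RepresentationTheory.KonnoKonno2007

namespace RealDualPair

/-! ## 0. Two missing `Kronecker` sign lemmas -/

/-- `(-A) ⊗ₖ B = -(A ⊗ₖ B)`. [folklore] -/
theorem neg_kronecker_left {l m n p : Type*} (A : Matrix l m ℂ) (B : Matrix n p ℂ) :
    (-A) ⊗ₖ B = -(A ⊗ₖ B) := by
  ext ⟨i, j⟩ ⟨i', j'⟩
  simp [Matrix.kroneckerMap_apply]

/-- `A ⊗ₖ (-B) = -(A ⊗ₖ B)`. [folklore] -/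
theorem kronecker_neg_right {l m n p : Type*} (A : Matrix l m ℂ) (B : Matrix n p ℂ) :
    A ⊗ₖ (-B) = -(A ⊗ₖ B) := by
  ext ⟨i, j⟩ ⟨i', j'⟩
  simp [Matrix.kroneckerMap_apply]

/-! ## 1. Sign forms `diag(1_α, −1_β)` and the indefinite unitary groups `U(α, β)` -/

section SignForm

variable (α β : Type*) [Fintype α] [DecidableEq α] [Fintype β] [DecidableEq β]

/-- The diagonal hermitian form `diag(1_α, −1_β)` of signature `(|α|, |β|)`. [folklore] -/
abbrev signForm : Matrix (α ⊕ β) (α ⊕ β) ℂ := Matrix.fromBlocks 1 0 0 (-1)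

/-- **`U(α, β) = U(⋆, diag(1_α, −1_β)) ≤ GL_{α ⊕ β}(ℂ)`** — the real points of the unitary group of a hermitian
space of signature `(|α|, |β|)` in a diagonal frame. [cite: MoeglinVignerasWaldspurger1987, Ch. 1 I.17] -/
abbrev UForm : Type _ := ↥(unitaryGroupOfForm (starRingEnd ℂ) (signForm α β))

omit [Fintype α] [Fintype β] in
/-- `diag(1_α, −1_β) = diagonal (±1)`. [folklore] -/
theorem signForm_eq_diagonal : signForm α β = Matrix.diagonal (Sum.elim (fun _ => (1 : ℂ)) fun _ => -1) := by
  ext (i | i) (j | j)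
  · by_cases h : i = j <;> simp [h]
  · simp
  · simp
  · by_cases h : i = j <;> simp [h]

variable {α β}

/-- `(diag(1,−1) y)_{inl a} = y_{inl a}`. [folklore] -/
@[simp] theorem signForm_mulVec_inl (y : α ⊕ β → ℂ) (a : α) : (signForm α β *ᵥ y) (Sum.inl a) = y (Sum.inl a) := by
  rw [signForm_eq_diagonal, Matrix.mulVec_diagonal, Sum.elim_inl, one_mul]

/-- `(diag(1,−1) y)_{inr b} = −y_{inr b}`. [folklore] -/
@[simp] theorem signForm_mulVec_inr (y : α ⊕ β → ℂ) (b : β) : (signForm α β *ᵥ y) (Sum.inr b) = -y (Sum.inr b) := by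
  rw [signForm_eq_diagonal, Matrix.mulVec_diagonal, Sum.elim_inr, neg_one_mul]

end SignForm

namespace UForm

section Compact

variable {n : Type*} [Fintype n] [DecidableEq n]

/-- A unitary matrix is in `U(⋆, −1)`: `uᴴ (−1) u = −1`. [folklore] -/
theorem toUnits_mem_unitaryGroupOfForm_neg_one (u : Matrix.unitaryGroup n ℂ) :
    (Unitary.toUnits u : GL n ℂ) ∈ unitaryGroupOfForm (starRingEnd ℂ) (-1 : Matrix n n ℂ) := by
  rw [mem_unitaryGroupOfForm_star_iff_conjTranspose, Matrix.mul_neg, Matrix.mul_one, Matrix.neg_mul]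
  exact congrArg Neg.neg (Matrix.UnitaryGroup.star_mul_self u)

variable (n)

/-- `U(n) →* U(⋆, 1_n)` (Mathlib's unitary group into the tree's `unitaryGroupOfForm`). [folklore] -/
def ofUnitaryOne : Matrix.unitaryGroup n ℂ →* ↥(unitaryGroupOfForm (starRingEnd ℂ) (1 : Matrix n n ℂ)) :=
  (Unitary.toUnits : Matrix.unitaryGroup n ℂ →* GL n ℂ).codRestrict _ toUnits_mem_unitaryGroupOfForm_one

/-- `U(n) →* U(⋆, −1_n)`. [folklore] -/
def ofUnitaryNegOne : Matrix.unitaryGroup n ℂ →* ↥(unitaryGroupOfForm (starRingEnd ℂ) (-1 : Matrix n n ℂ)) :=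
  (Unitary.toUnits : Matrix.unitaryGroup n ℂ →* GL n ℂ).codRestrict _ toUnits_mem_unitaryGroupOfForm_neg_one

variable {n}

/-- matrix of `ofUnitaryOne u` is `u`. [folklore] -/
@[simp] theorem coe_ofUnitaryOne (u : Matrix.unitaryGroup n ℂ) :
    (((ofUnitaryOne n u : ↥(unitaryGroupOfForm (starRingEnd ℂ) (1 : Matrix n n ℂ))) : GL n ℂ) : Matrix n n ℂ) =
      (u : Matrix n n ℂ) := rfl

/-- matrix of `ofUnitaryNegOne u` is `u`. [folklore] -/
@[simp] theorem coe_ofUnitaryNegOne (u : Matrix.unitaryGroup n ℂ) :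
    (((ofUnitaryNegOne n u : ↥(unitaryGroupOfForm (starRingEnd ℂ) (-1 : Matrix n n ℂ))) : GL n ℂ) : Matrix n n ℂ) =
      (u : Matrix n n ℂ) := rfl

/-- `Unitary.toUnits : U(n) → GL_n(ℂ)` is continuous. [folklore] -/
theorem continuous_toUnits : Continuous (Unitary.toUnits : Matrix.unitaryGroup n ℂ → GL n ℂ) := by
  refine Units.continuous_iff.2 ⟨continuous_subtype_val, ?_⟩
  have h : ∀ u : Matrix.unitaryGroup n ℂ,
      (((Unitary.toUnits u)⁻¹ : GL n ℂ) : Matrix n n ℂ) = star ((u : Matrix.unitaryGroup n ℂ) : Matrix n n ℂ) :=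
    fun u => rfl
  simp_rw [h]
  exact continuous_subtype_val.star

/-- `ofUnitaryOne` is continuous. [folklore] -/
theorem continuous_ofUnitaryOne : Continuous (ofUnitaryOne n) :=
  Continuous.subtype_mk continuous_toUnits fun u => toUnits_mem_unitaryGroupOfForm_one u

/-- `ofUnitaryNegOne` is continuous. [folklore] -/
theorem continuous_ofUnitaryNegOne : Continuous (ofUnitaryNegOne n) :=
  Continuous.subtype_mk continuous_toUnits fun u => toUnits_mem_unitaryGroupOfForm_neg_one u

variable (α β : Type*) [Fintype α] [DecidableEq α] [Fintype β] [DecidableEq β]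

/-- **The maximal compact `U(α) × U(β) →* U(α, β)`, `(a, b) ↦ diag(a, b)`.** [cite: KonnoKonno2007, §3.1] -/
def kV : Matrix.unitaryGroup α ℂ × Matrix.unitaryGroup β ℂ →* UForm α β :=
  (blockDiag (starRingEnd ℂ) (1 : Matrix α α ℂ) (-1 : Matrix β β ℂ)).comp
    ((ofUnitaryOne α).prodMap (ofUnitaryNegOne β))

variable {α β}

/-- matrix of `kV (a, b)`: `diag(a, b)`. [folklore] -/
@[simp] theorem coe_kV (k : Matrix.unitaryGroup α ℂ × Matrix.unitaryGroup β ℂ) :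
    (((kV α β k : UForm α β) : GL (α ⊕ β) ℂ) : Matrix (α ⊕ β) (α ⊕ β) ℂ) =
      Matrix.fromBlocks (k.1 : Matrix α α ℂ) 0 0 (k.2 : Matrix β β ℂ) := rfl

/-- `kV` is continuous. [folklore] -/
theorem continuous_kV : Continuous (kV α β) :=
  (continuous_blockDiag (starRingEnd ℂ) (1 : Matrix α α ℂ) (-1 : Matrix β β ℂ)).comp
    (continuous_ofUnitaryOne.prodMap continuous_ofUnitaryNegOne)

end Compact

end UForm

/-! ## 2. Twisted realification: `U(α, β) →* Sp(ℝ^{α ⊕ β} × ℝ^{α ⊕ β})` -/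

section Twist

variable {α β : Type*} [Fintype α] [DecidableEq α] [Fintype β] [DecidableEq β]

/-- **The twist**: conjugate the `α`-coordinates (`Sum.inl`), keep the `β`-coordinates. [folklore] -/
def tw (x : α ⊕ β → ℂ) : α ⊕ β → ℂ := Sum.elim (fun a => star (x (Sum.inl a))) fun b => x (Sum.inr b)

omit [Fintype α] [DecidableEq α] [Fintype β] [DecidableEq β] in
/-- formula. [folklore] -/
@[simp] theorem tw_inl (x : α ⊕ β → ℂ) (a : α) : tw x (Sum.inl a) = star (x (Sum.inl a)) := rfl

omit [Fintype α] [DecidableEq α] [Fintype β] [DecidableEq β] in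
/-- formula. [folklore] -/
@[simp] theorem tw_inr (x : α ⊕ β → ℂ) (b : β) : tw x (Sum.inr b) = x (Sum.inr b) := rfl

omit [Fintype α] [DecidableEq α] [Fintype β] [DecidableEq β] in
/-- `tw` is an involution. [folklore] -/
@[simp] theorem tw_tw (x : α ⊕ β → ℂ) : tw (tw x) = x := by
  ext (a | b) <;> simp

omit [Fintype α] [DecidableEq α] [Fintype β] [DecidableEq β] in
/-- `tw` is additive. [folklore] -/
theorem tw_add (x y : α ⊕ β → ℂ) : tw (x + y) = tw x + tw y := by
  ext (a | b) <;> simp [star_add]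

omit [Fintype α] [DecidableEq α] [Fintype β] [DecidableEq β] in
/-- `tw` is real-homogeneous. [folklore] -/
theorem tw_smul_real (c : ℝ) (x : α ⊕ β → ℂ) : tw ((c : ℂ) • x) = (c : ℂ) • tw x := by
  ext (a | b) <;> simp [Complex.conj_ofReal]

/-- **The twisted action** of a complex matrix: `x ↦ tw (M (tw x))`. [folklore] -/
def twMulVec (M : Matrix (α ⊕ β) (α ⊕ β) ℂ) (x : α ⊕ β → ℂ) : α ⊕ β → ℂ := tw (M *ᵥ tw x)

omit [DecidableEq α] [DecidableEq β] in
/-- the twisted action is multiplicative (`tw` is an involution). [folklore] -/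
theorem twMulVec_mul (M N : Matrix (α ⊕ β) (α ⊕ β) ℂ) (x : α ⊕ β → ℂ) :
    twMulVec (M * N) x = twMulVec M (twMulVec N x) := by
  simp only [twMulVec, tw_tw, Matrix.mulVec_mulVec]

/-- `twMulVec 1 = id`. [folklore] -/
theorem twMulVec_one (x : α ⊕ β → ℂ) : twMulVec (1 : Matrix (α ⊕ β) (α ⊕ β) ℂ) x = x := by
  simp only [twMulVec, Matrix.one_mulVec, tw_tw]

omit [DecidableEq α] [DecidableEq β] in
/-- additivity. [folklore] -/
theorem twMulVec_add (M : Matrix (α ⊕ β) (α ⊕ β) ℂ) (x y : α ⊕ β → ℂ) :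
    twMulVec M (x + y) = twMulVec M x + twMulVec M y := by
  simp only [twMulVec, tw_add, Matrix.mulVec_add]

omit [DecidableEq α] [DecidableEq β] in
/-- real homogeneity. [folklore] -/
theorem twMulVec_smul_real (M : Matrix (α ⊕ β) (α ⊕ β) ℂ) (c : ℝ) (x : α ⊕ β → ℂ) :
    twMulVec M ((c : ℂ) • x) = (c : ℂ) • twMulVec M x := by
  simp only [twMulVec, tw_smul_real, Matrix.mulVec_smul]

omit [DecidableEq α] [DecidableEq β] in
/-- **On a block-diagonal matrix the twisted action is the plain action of `diag(M̄₁, M₂)`.** [folklore] -/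
theorem twMulVec_fromBlocks (M₁ : Matrix α α ℂ) (M₂ : Matrix β β ℂ) (x : α ⊕ β → ℂ) :
    twMulVec (Matrix.fromBlocks M₁ 0 0 M₂) x = Matrix.fromBlocks (M₁.map star) 0 0 M₂ *ᵥ x := by
  ext (a | b)
  · simp [twMulVec, Matrix.mulVec, dotProduct, Fintype.sum_sum_type, Matrix.fromBlocks_apply₁₁,
      Matrix.fromBlocks_apply₁₂, star_sum, tw]
  · simp [twMulVec, Matrix.mulVec, dotProduct, Fintype.sum_sum_type, Matrix.fromBlocks_apply₂₁,
      Matrix.fromBlocks_apply₂₂, tw]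

/-- **The twist turns `diag(1,−1)` into the standard form**: `Im(conj(tw Y)ᵀ tw Y′) = −Im(Ȳᵀ diag(1,−1) Y′)`.
[folklore] -/
theorem im_star_tw_dotProduct_tw (Y Y' : α ⊕ β → ℂ) :
    (star (tw Y) ⬝ᵥ tw Y').im = -(star Y ⬝ᵥ (signForm α β *ᵥ Y')).im := by
  classical
  simp only [dotProduct, Fintype.sum_sum_type, Pi.star_apply, tw_inl, tw_inr, star_star, signForm_mulVec_inl,
    signForm_mulVec_inr, Complex.add_im, Complex.im_sum, neg_add, mul_neg, Complex.neg_im, Finset.sum_neg_distrib,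
    neg_neg]
  congr 1
  rw [← Finset.sum_neg_distrib]
  refine Finset.sum_congr rfl fun a _ => ?_
  simp only [Complex.mul_im, Complex.star_def, Complex.conj_re, Complex.conj_im]
  ring

omit [DecidableEq α] [DecidableEq β] in
/-- `conj(Mx)ᵀ D (My) = x̄ᵀ (Mᴴ D M) y`. [folklore] -/
theorem star_mulVec_dotProduct_mulVec_mulVec (M D : Matrix (α ⊕ β) (α ⊕ β) ℂ) (x y : α ⊕ β → ℂ) :
    star (M *ᵥ x) ⬝ᵥ (D *ᵥ (M *ᵥ y)) = star x ⬝ᵥ ((Mᴴ * D * M) *ᵥ y) := by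
  rw [Matrix.star_mulVec, Matrix.mulVec_mulVec, Matrix.dotProduct_mulVec, Matrix.dotProduct_mulVec,
    Matrix.vecMul_vecMul, Matrix.mul_assoc]

/-- **A `diag(1,−1)`-unitary matrix acts symplectically through the twist**: if `Mᴴ D M = D` then
`Im(conj(twMulVec M X)ᵀ (twMulVec M X′)) = Im(X̄ᵀ X′)`. [folklore] -/
theorem im_star_twMulVec_dotProduct_twMulVec {M : Matrix (α ⊕ β) (α ⊕ β) ℂ}
    (hM : Mᴴ * signForm α β * M = signForm α β) (X X' : α ⊕ β → ℂ) :
    (star (twMulVec M X) ⬝ᵥ twMulVec M X').im = (star X ⬝ᵥ X').im := by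
  have h := im_star_tw_dotProduct_tw (tw X) (tw X')
  rw [tw_tw, tw_tw] at h
  rw [twMulVec, twMulVec, im_star_tw_dotProduct_tw, star_mulVec_dotProduct_mulVec_mulVec, hM, h]

/-- **The twisted realification** of `M` as a map of phase space `ℝ^{α⊕β} × ℝ^{α⊕β}`:
`(p, q) ↦ (Re, Im)(tw (M (tw (p + iq))))`. [folklore] -/
def twRealify (M : Matrix (α ⊕ β) (α ⊕ β) ℂ) : PhaseMap (α ⊕ β) := fun pq =>
  (fun k => (twMulVec M (phasePt pq.1 pq.2) k).re, fun k => (twMulVec M (phasePt pq.1 pq.2) k).im)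

omit [DecidableEq α] [DecidableEq β] in
/-- `phasePt` of the image: `tw (M (tw (p + iq)))`. [folklore] -/
theorem phasePt_twRealify (M : Matrix (α ⊕ β) (α ⊕ β) ℂ) (pq : (α ⊕ β → ℝ) × (α ⊕ β → ℝ)) :
    phasePt (twRealify M pq).1 (twRealify M pq).2 = twMulVec M (phasePt pq.1 pq.2) :=
  phasePt_re_im _

omit [Fintype α] [DecidableEq α] [Fintype β] [DecidableEq β] in
/-- `phasePt` is additive in the pair. [folklore] -/
theorem phasePt_fst_snd_add (w w' : (α ⊕ β → ℝ) × (α ⊕ β → ℝ)) :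
    phasePt (w + w').1 (w + w').2 = phasePt w.1 w.2 + phasePt w'.1 w'.2 := by
  ext k
  simp only [Prod.fst_add, Prod.snd_add, phasePt_apply, Pi.add_apply, Complex.ofReal_add]
  ring

omit [Fintype α] [DecidableEq α] [Fintype β] [DecidableEq β] in
/-- `phasePt` is real-homogeneous in the pair. [folklore] -/
theorem phasePt_fst_snd_smul (c : ℝ) (w : (α ⊕ β → ℝ) × (α ⊕ β → ℝ)) :
    phasePt (c • w).1 (c • w).2 = (c : ℂ) • phasePt w.1 w.2 := by
  rw [Prod.smul_fst, Prod.smul_snd, phasePt_smul]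

omit [DecidableEq α] [DecidableEq β] in
/-- additivity. [folklore] -/
theorem twRealify_add (M : Matrix (α ⊕ β) (α ⊕ β) ℂ) (w w' : (α ⊕ β → ℝ) × (α ⊕ β → ℝ)) :
    twRealify M (w + w') = twRealify M w + twRealify M w' := by
  apply pv_ext
  rw [phasePt_twRealify, phasePt_fst_snd_add, phasePt_fst_snd_add, phasePt_twRealify, phasePt_twRealify,
    twMulVec_add]

omit [DecidableEq α] [DecidableEq β] in
/-- real homogeneity. [folklore] -/
theorem twRealify_smul (M : Matrix (α ⊕ β) (α ⊕ β) ℂ) (c : ℝ) (w : (α ⊕ β → ℝ) × (α ⊕ β → ℝ)) :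
    twRealify M (c • w) = c • twRealify M w := by
  apply pv_ext
  rw [phasePt_twRealify, phasePt_fst_snd_smul, phasePt_fst_snd_smul, phasePt_twRealify, twMulVec_smul_real]

omit [DecidableEq α] [DecidableEq β] in
/-- multiplicativity. [folklore] -/
theorem twRealify_mul (M N : Matrix (α ⊕ β) (α ⊕ β) ℂ) (w : (α ⊕ β → ℝ) × (α ⊕ β → ℝ)) :
    twRealify (M * N) w = twRealify M (twRealify N w) := by
  apply pv_ext
  rw [phasePt_twRealify, phasePt_twRealify, phasePt_twRealify, twMulVec_mul]

/-- unit. [folklore] -/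
theorem twRealify_one (w : (α ⊕ β → ℝ) × (α ⊕ β → ℝ)) : twRealify (1 : Matrix (α ⊕ β) (α ⊕ β) ℂ) w = w := by
  apply pv_ext
  rw [phasePt_twRealify, twMulVec_one]

/-- **The twisted realification of an invertible matrix as a real-linear automorphism of phase space.**
[folklore] -/
def twRealifyLin (g : GL (α ⊕ β) ℂ) : ((α ⊕ β → ℝ) × (α ⊕ β → ℝ)) ≃ₗ[ℝ] ((α ⊕ β → ℝ) × (α ⊕ β → ℝ)) where
  toFun := twRealify (g : Matrix (α ⊕ β) (α ⊕ β) ℂ)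
  invFun := twRealify ((g⁻¹ : GL (α ⊕ β) ℂ) : Matrix (α ⊕ β) (α ⊕ β) ℂ)
  map_add' := twRealify_add _
  map_smul' := twRealify_smul _
  left_inv w := by
    rw [← twRealify_mul, ← Units.val_mul, inv_mul_cancel, Units.val_one, twRealify_one]
  right_inv w := by
    rw [← twRealify_mul, ← Units.val_mul, mul_inv_cancel, Units.val_one, twRealify_one]

/-- Unfolding. [folklore] -/
@[simp] theorem coe_twRealifyLin (g : GL (α ⊕ β) ℂ) :
    ⇑(twRealifyLin g) = twRealify (g : Matrix (α ⊕ β) (α ⊕ β) ℂ) := rfl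

/-- **`twRealifyLin g` is symplectic for `g ∈ U(α, β)`**: it preserves `p·q′ − p′·q`.
[cite: MoeglinVignerasWaldspurger1987, Ch. 1 I.17] -/
theorem twRealifyLin_mem_symplecticGroup (g : GL (α ⊕ β) ℂ)
    (hg : g ∈ unitaryGroupOfForm (starRingEnd ℂ) (signForm α β)) :
    twRealifyLin g ∈ symplecticGroup (polar (dotPairing (α ⊕ β))) := by
  rw [mem_unitaryGroupOfForm_star_iff_conjTranspose] at hg
  rw [mem_symplecticGroup]
  intro w w'
  simp only [polar_apply, dotPairing_apply, coe_twRealifyLin]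
  rw [← im_star_phasePt_dotProduct, ← im_star_phasePt_dotProduct, phasePt_twRealify, phasePt_twRealify,
    im_star_twMulVec_dotProduct_twMulVec hg]

variable (α β)

/-- **`U(α, β) →* Sp(ℝ^{α⊕β} × ℝ^{α⊕β})`** — the indefinite unitary group in the symplectic group of the underlying
real space, in the twisted (Fock-adapted) coordinates. [cite: MoeglinVignerasWaldspurger1987, Ch. 1 I.17] -/
def UForm.toSp : UForm α β →* symplecticGroup (polar (dotPairing (α ⊕ β))) where
  toFun g := ⟨twRealifyLin (g : GL (α ⊕ β) ℂ), twRealifyLin_mem_symplecticGroup _ g.2⟩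
  map_one' := by
    apply Subtype.ext
    apply LinearEquiv.ext
    intro w
    show twRealify (((1 : UForm α β) : GL (α ⊕ β) ℂ) : Matrix (α ⊕ β) (α ⊕ β) ℂ) w = w
    rw [OneMemClass.coe_one, Units.val_one]
    exact twRealify_one w
  map_mul' g g' := by
    apply Subtype.ext
    apply LinearEquiv.ext
    intro w
    show twRealify (((g * g' : UForm α β) : GL (α ⊕ β) ℂ) : Matrix (α ⊕ β) (α ⊕ β) ℂ) w =
      twRealify ((g : GL (α ⊕ β) ℂ) : Matrix (α ⊕ β) (α ⊕ β) ℂ)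
        (twRealify ((g' : GL (α ⊕ β) ℂ) : Matrix (α ⊕ β) (α ⊕ β) ℂ) w)
    rw [Subgroup.coe_mul, Units.val_mul]
    exact twRealify_mul _ _ w

variable {α β}

/-- Unfolding: the underlying map of `toSp g` is `twRealify g`. [folklore] -/
@[simp] theorem UForm.coe_toSp (g : UForm α β) :
    ⇑((UForm.toSp α β g).1 : ((α ⊕ β → ℝ) × (α ⊕ β → ℝ)) ≃ₗ[ℝ] ((α ⊕ β → ℝ) × (α ⊕ β → ℝ))) =
      twRealify ((g : GL (α ⊕ β) ℂ) : Matrix (α ⊕ β) (α ⊕ β) ℂ) := rfl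

/-- **On block-unitary elements the twisted realification is the tree's `realifySp` of `diag(M̄₁, M₂)`.**
[cite: Folland1989, Prop. (4.39)] -/
theorem UForm.toSp_eq_realifySp (g : UForm α β) (U : Matrix.unitaryGroup (α ⊕ β) ℂ) (M₁ : Matrix α α ℂ)
    (M₂ : Matrix β β ℂ) (hg : ((g : GL (α ⊕ β) ℂ) : Matrix (α ⊕ β) (α ⊕ β) ℂ) = Matrix.fromBlocks M₁ 0 0 M₂)
    (hU : (U : Matrix (α ⊕ β) (α ⊕ β) ℂ) = Matrix.fromBlocks (M₁.map star) 0 0 M₂) :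
    UForm.toSp α β g = realifySp (α ⊕ β) U := by
  apply Subtype.ext
  apply LinearEquiv.ext
  intro w
  apply pv_ext
  rw [UForm.coe_toSp, coe_realifySp, phasePt_twRealify, phasePt_realify, hg, hU, twMulVec_fromBlocks]

end Twist

/-! ## 3. The block frame `(P ⊕ Q) × (R ⊕ S) ≃ DPIdx P Q R S` -/

section Frame

variable (P Q R S : Type*) [Fintype P] [DecidableEq P] [Fintype Q] [DecidableEq Q] [Fintype R] [DecidableEq R]
  [Fintype S] [DecidableEq S]

/-- **The block relabelling of `V ⊗ W`**: `(P ⊕ Q) × (R ⊕ S) ≃ ((P × R) ⊕ (Q × S)) ⊕ ((P × S) ⊕ (Q × R))`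
(same-sign blocks first, then the mixed ones). [folklore] -/
def dpEquiv : (P ⊕ Q) × (R ⊕ S) ≃ DPIdx P Q R S where
  toFun
    | (Sum.inl p, Sum.inl r) => Sum.inl (Sum.inl (p, r))
    | (Sum.inr q, Sum.inr s) => Sum.inl (Sum.inr (q, s))
    | (Sum.inl p, Sum.inr s) => Sum.inr (Sum.inl (p, s))
    | (Sum.inr q, Sum.inl r) => Sum.inr (Sum.inr (q, r))
  invFun
    | Sum.inl (Sum.inl (p, r)) => (Sum.inl p, Sum.inl r)
    | Sum.inl (Sum.inr (q, s)) => (Sum.inr q, Sum.inr s)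
    | Sum.inr (Sum.inl (p, s)) => (Sum.inl p, Sum.inr s)
    | Sum.inr (Sum.inr (q, r)) => (Sum.inr q, Sum.inl r)
  left_inv := by rintro ⟨p | q, r | s⟩ <;> rfl
  right_inv := by rintro ((⟨p, r⟩ | ⟨q, s⟩) | (⟨p, s⟩ | ⟨q, r⟩)) <;> rfl

variable {P Q R S}

omit [Fintype P] [DecidableEq P] [Fintype Q] [DecidableEq Q] [Fintype R] [DecidableEq R] [Fintype S]
  [DecidableEq S] in
/-- `dpEquiv⁻¹` on the `P × R` block. [folklore] -/
@[simp] theorem dpEquiv_symm_inl_inl (p : P) (r : R) :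
    (dpEquiv P Q R S).symm (Sum.inl (Sum.inl (p, r))) = (Sum.inl p, Sum.inl r) := rfl

omit [Fintype P] [DecidableEq P] [Fintype Q] [DecidableEq Q] [Fintype R] [DecidableEq R] [Fintype S]
  [DecidableEq S] in
/-- `dpEquiv⁻¹` on the `Q × S` block. [folklore] -/
@[simp] theorem dpEquiv_symm_inl_inr (q : Q) (s : S) :
    (dpEquiv P Q R S).symm (Sum.inl (Sum.inr (q, s))) = (Sum.inr q, Sum.inr s) := rfl

omit [Fintype P] [DecidableEq P] [Fintype Q] [DecidableEq Q] [Fintype R] [DecidableEq R] [Fintype S]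
  [DecidableEq S] in
/-- `dpEquiv⁻¹` on the `P × S` block. [folklore] -/
@[simp] theorem dpEquiv_symm_inr_inl (p : P) (s : S) :
    (dpEquiv P Q R S).symm (Sum.inr (Sum.inl (p, s))) = (Sum.inl p, Sum.inr s) := rfl

omit [Fintype P] [DecidableEq P] [Fintype Q] [DecidableEq Q] [Fintype R] [DecidableEq R] [Fintype S]
  [DecidableEq S] in
/-- `dpEquiv⁻¹` on the `Q × R` block. [folklore] -/
@[simp] theorem dpEquiv_symm_inr_inr (q : Q) (r : R) :
    (dpEquiv P Q R S).symm (Sum.inr (Sum.inr (q, r))) = (Sum.inr q, Sum.inl r) := rfl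

omit [Fintype P] [DecidableEq P] [Fintype Q] [DecidableEq Q] [Fintype R] [DecidableEq R] [Fintype S]
  [DecidableEq S] in
/-- **In the block frame, the Kronecker product of two block-diagonal matrices is 4-block-diagonal**:
`diag(a,b) ⊗ diag(c,d) ↦ diag(a⊗c, b⊗d, a⊗d, b⊗c)`. [folklore] -/
theorem reindex_kronecker_fromBlocks (a : Matrix P P ℂ) (b : Matrix Q Q ℂ) (c : Matrix R R ℂ)
    (d : Matrix S S ℂ) :
    Matrix.reindex (dpEquiv P Q R S) (dpEquiv P Q R S) (Matrix.fromBlocks a 0 0 b ⊗ₖ Matrix.fromBlocks c 0 0 d) =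
      Matrix.fromBlocks (Matrix.fromBlocks (a ⊗ₖ c) 0 0 (b ⊗ₖ d)) 0 0
        (Matrix.fromBlocks (a ⊗ₖ d) 0 0 (b ⊗ₖ c)) := by
  ext ((⟨p, r⟩ | ⟨q, s⟩) | (⟨p, s⟩ | ⟨q, r⟩)) ((⟨p', r'⟩ | ⟨q', s'⟩) | (⟨p', s'⟩ | ⟨q', r'⟩)) <;>
    simp [Matrix.reindex_apply, Matrix.submatrix_apply]

omit [Fintype P] [Fintype Q] [Fintype R] [Fintype S] in
/-- **The hermitian form `H_V ⊗ H_W` in the block frame is `diag(+1 same-sign, −1 mixed)`.** [folklore] -/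
theorem reindex_signForm_kronecker :
    Matrix.reindex (dpEquiv P Q R S) (dpEquiv P Q R S) (signForm P Q ⊗ₖ signForm R S) =
      signForm ((P × R) ⊕ (Q × S)) ((P × S) ⊕ (Q × R)) := by
  have h1 : (-1 : Matrix Q Q ℂ) ⊗ₖ (-1 : Matrix S S ℂ) = 1 := by
    rw [neg_kronecker_left, kronecker_neg_right, neg_neg, Matrix.one_kronecker_one]
  have h2 : (1 : Matrix P P ℂ) ⊗ₖ (-1 : Matrix S S ℂ) = -1 := by
    rw [kronecker_neg_right, Matrix.one_kronecker_one]
  have h3 : (-1 : Matrix Q Q ℂ) ⊗ₖ (1 : Matrix R R ℂ) = -1 := by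
    rw [neg_kronecker_left, Matrix.one_kronecker_one]
  have h4 : Matrix.fromBlocks (-1 : Matrix (P × S) (P × S) ℂ) 0 0 (-1 : Matrix (Q × R) (Q × R) ℂ) = -1 := by
    rw [← Matrix.fromBlocks_one, Matrix.fromBlocks_neg, neg_zero, neg_zero]
  rw [signForm, signForm, reindex_kronecker_fromBlocks, Matrix.one_kronecker_one, h1, h2, h3, Matrix.fromBlocks_one,
    h4]

end Frame

/-! ## 4. The instance: `Ginf = U(P,Q) × U(R,S)`, `ι𝕎`, `κ`, and `junction` -/

section Instance

variable (P Q R S : Type*) [Fintype P] [DecidableEq P] [Fintype Q] [DecidableEq Q] [Fintype R] [DecidableEq R]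
  [Fintype S] [DecidableEq S]

/-- **`G_∞ = U(P,Q) × U(R,S)`** — the real unitary dual pair. [cite: KonnoKonno2007, §3.1 (3.1)] -/
abbrev Ginf : Type _ := UForm P Q × UForm R S

/-- `U(⋆, reindex (H_V ⊗ H_W)) = U(⋆, diag(+1, −1))` in the block frame. [folklore] -/
theorem unitaryGroupOfForm_reindex_kronecker_eq :
    unitaryGroupOfForm (starRingEnd ℂ)
        (Matrix.reindex (dpEquiv P Q R S) (dpEquiv P Q R S) (signForm P Q ⊗ₖ signForm R S)) =
      unitaryGroupOfForm (starRingEnd ℂ) (signForm ((P × R) ⊕ (Q × S)) ((P × S) ⊕ (Q × R))) := by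
  rw [reindex_signForm_kronecker]

/-- **`(g_V, g_W) ↦ g_V ⊗ g_W` in the block frame**, as a homomorphism `G_∞ →* U(same-sign, mixed)`.
[cite: MoeglinVignerasWaldspurger1987, Ch. 1 I.17] -/
def toBig : Ginf P Q R S →* UForm ((P × R) ⊕ (Q × S)) ((P × S) ⊕ (Q × R)) :=
  (MulEquiv.subgroupCongr (unitaryGroupOfForm_reindex_kronecker_eq P Q R S)).toMonoidHom.comp
    ((reindexU (starRingEnd ℂ) (dpEquiv P Q R S) (signForm P Q ⊗ₖ signForm R S)).comp
      (dualPair (starRingEnd ℂ) (signForm P Q) (signForm R S)))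

variable {P Q R S}

/-- matrix of `toBig (g_V, g_W)`: `reindex dpEquiv dpEquiv (g_V ⊗ₖ g_W)`. [folklore] -/
@[simp] theorem coe_toBig (g : Ginf P Q R S) :
    (((toBig P Q R S g : UForm ((P × R) ⊕ (Q × S)) ((P × S) ⊕ (Q × R))) : GL (DPIdx P Q R S) ℂ) :
        Matrix (DPIdx P Q R S) (DPIdx P Q R S) ℂ) =
      Matrix.reindex (dpEquiv P Q R S) (dpEquiv P Q R S)
        (((g.1 : GL (P ⊕ Q) ℂ) : Matrix (P ⊕ Q) (P ⊕ Q) ℂ) ⊗ₖ ((g.2 : GL (R ⊕ S) ℂ) : Matrix (R ⊕ S) (R ⊕ S) ℂ)) :=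
  rfl

variable (P Q R S)

/-- **`ι_{V,W} : G_∞ →* Sp(𝕎)`** in the tree's block coordinates `DPIdx P Q R S` (twisted realification of
`g_V ⊗ g_W`). [cite: KonnoKonno2007, §3.1 (3.1)] -/
def ι𝕎 : Ginf P Q R S →* symplecticGroup (polar (dotPairing (DPIdx P Q R S))) :=
  (UForm.toSp ((P × R) ⊕ (Q × S)) ((P × S) ⊕ (Q × R))).comp (toBig P Q R S)

/-- **`κ : K_V × K_W = (U(P) × U(Q)) × (U(R) × U(S)) →* G_∞`**, `((a,b),(c,d)) ↦ (diag(a,b), diag(c,d))`.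
[cite: KonnoKonno2007, §3.1] -/
def κ : DPK P Q R S →* Ginf P Q R S := (UForm.kV P Q).prodMap (UForm.kV R S)

variable {P Q R S}

/-- **The working formula for `ι𝕎`**: `phasePt (ι𝕎 g (p,q)) = tw (reindex (g_V ⊗ g_W) (tw (p + iq)))`. [folklore] -/
theorem phasePt_ι𝕎 (g : Ginf P Q R S) (w : (DPIdx P Q R S → ℝ) × (DPIdx P Q R S → ℝ)) :
    phasePt (((ι𝕎 P Q R S g).1 w).1) (((ι𝕎 P Q R S g).1 w).2) =
      twMulVec (Matrix.reindex (dpEquiv P Q R S) (dpEquiv P Q R S)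
        (((g.1 : GL (P ⊕ Q) ℂ) : Matrix (P ⊕ Q) (P ⊕ Q) ℂ) ⊗ₖ ((g.2 : GL (R ⊕ S) ℂ) : Matrix (R ⊕ S) (R ⊕ S) ℂ)))
        (phasePt w.1 w.2) := by
  rw [← coe_toBig]
  exact phasePt_twRealify _ w

/-- `ι𝕎 g` as a function of phase space. [folklore] -/
theorem ι𝕎_apply (g : Ginf P Q R S) (w : (DPIdx P Q R S → ℝ) × (DPIdx P Q R S → ℝ)) :
    (ι𝕎 P Q R S g).1 w =
      twRealify (Matrix.reindex (dpEquiv P Q R S) (dpEquiv P Q R S)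
        (((g.1 : GL (P ⊕ Q) ℂ) : Matrix (P ⊕ Q) (P ⊕ Q) ℂ) ⊗ₖ ((g.2 : GL (R ⊕ S) ℂ) : Matrix (R ⊕ S) (R ⊕ S) ℂ))) w :=
  rfl

/-- `κ` is continuous. [folklore] -/
theorem continuous_κ : Continuous (κ P Q R S) :=
  UForm.continuous_kV.prodMap UForm.continuous_kV

/-- matrix of the first component of `κ k`: `diag(a, b)`. [folklore] -/
@[simp] theorem coe_κ_fst (k : DPK P Q R S) :
    (((κ P Q R S k).1 : GL (P ⊕ Q) ℂ) : Matrix (P ⊕ Q) (P ⊕ Q) ℂ) =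
      Matrix.fromBlocks (k.1.1 : Matrix P P ℂ) 0 0 (k.1.2 : Matrix Q Q ℂ) := rfl

/-- matrix of the second component of `κ k`: `diag(c, d)`. [folklore] -/
@[simp] theorem coe_κ_snd (k : DPK P Q R S) :
    (((κ P Q R S k).2 : GL (R ⊕ S) ℂ) : Matrix (R ⊕ S) (R ⊕ S) ℂ) =
      Matrix.fromBlocks (k.2.1 : Matrix R R ℂ) 0 0 (k.2.2 : Matrix S S ℂ) := rfl

/-- **Compatibility with the tree's compact datum**: `ι𝕎 (κ k) = realifySp (dualPairι k)`.
[cite: KonnoKonno2007, §3.1] -/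
theorem ι𝕎_κ (k : DPK P Q R S) : ι𝕎 P Q R S (κ P Q R S k) = realifySp (DPIdx P Q R S) (dualPairι k) := by
  refine UForm.toSp_eq_realifySp _ _
    (Matrix.fromBlocks ((k.1.1 : Matrix P P ℂ) ⊗ₖ (k.2.1 : Matrix R R ℂ)) 0 0
      ((k.1.2 : Matrix Q Q ℂ) ⊗ₖ (k.2.2 : Matrix S S ℂ)))
    (Matrix.fromBlocks ((k.1.1 : Matrix P P ℂ) ⊗ₖ (k.2.2 : Matrix S S ℂ)) 0 0
      ((k.1.2 : Matrix Q Q ℂ) ⊗ₖ (k.2.1 : Matrix R R ℂ))) ?_ ?_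
  · rw [coe_toBig, coe_κ_fst, coe_κ_snd, reindex_kronecker_fromBlocks]
  · rw [coe_dualPairι, Matrix.fromBlocks_map, Matrix.map_zero _ (star_zero ℂ), Matrix.map_zero _ (star_zero ℂ)]

variable (P Q R S)

/-- **THE INSTANCE: the real unitary dual pair `(U(P,Q), U(R,S))` in `Sp(𝕎)`, block coordinates of the tree,
with its maximal compact** — a `RealDualPairJunction`. [cite: KonnoKonno2007, §3.1 (3.1)] -/
def junction : RealDualPairJunction P Q R S (Ginf P Q R S) where
  ι𝕎 := ι𝕎 P Q R S
  κ := κ P Q R S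
  κ_continuous := continuous_κ
  ι𝕎_κ := ι𝕎_κ

/-- The junction's `ι𝕎` is this file's `ι𝕎`. [folklore] -/
@[simp] theorem junction_ι𝕎 : (junction P Q R S).ι𝕎 = ι𝕎 P Q R S := rfl

/-- The junction's `κ` is this file's `κ`. [folklore] -/
@[simp] theorem junction_κ : (junction P Q R S).κ = κ P Q R S := rfl

end Instance

end RealDualPair

end Literature.RepresentationTheory.KonnoKonno2007

end
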